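import Mathlib
import Summits.Ventures.HodgeRepro.Tier4.Common.AdelicDefs
import Summits.Ventures.HodgeRepro.Tier4.Common.AdelicRTF
import Summits.Ventures.HodgeRepro.Tier4.Common.MixedPlaneCusp
import Summits.Ventures.HodgeRepro.Tier4.Line1.PlaneDefs
import Summits.Ventures.HodgeRepro.Tier4.Line1.RationalPoints
import Summits.Ventures.HodgeRepro.Tier4.Line4.ThetaEquivariance
import Summits.Ventures.HodgeRepro.Tier4.Line4.GeometricSide
import Summits.Ventures.HodgeRepro.Tier4.Line4.OrbitalUnfold
import Summits.Ventures.HodgeRepro.Tier4.Line4.OrbitalUnfoldCentralCosets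

/-!
# Tier4/Line4/OrbitalUnfoldCentral — C-L4-UNFOLD-Z: the HALF-UNFOLDED orbital integral of a regular rational orbit —
inner integral over the whole `T′(𝔸)`, outer over a fundamental domain of the rational centre `Z(k)` in `T(𝔸)`

Blind re-derivation cell `pub-hodge-repro`, Tier 4 «PROVE THE STEP» (README §9–§10), LINE L4, cut C-L4-UNFOLD-Z
(t4-plan-4 g3 S14244: statement typed by the planner, taken S14245); seat t4-L2-p3 (gen 3).  Part 2 of 2; part 1 =
`Line4/OrbitalUnfoldCentralCosets` (the rational centre, the cosets `T(k)/Z(k)`, the orbit parametrisation (a)).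
Builds on t4-L4-p2's `Line4/OrbitalUnfold` (Theorem B `orbitalFull_eq_tsum_tsum`, `innerFn_shift`, `chi_rational_mul`,
`chi'conj_rational_mul`) and t4-L4-p1's `countable_rationalOf`; nothing of theirs is restated.

WHY (planner's barrier note S14244 (1)): OrbitalUnfold's Theorem C needs `hinj : Function.Injective (orbitMap W γ₀)`,
which is FALSE for every rational `γ₀` — the diagonal pairs `(z, z)`, `z ∈ Z(k)`, stabilise `γ₀`, and `Z(k)` is
infinite — and its (B1) over the whole `T(𝔸)` is unsatisfiable for a non-zero term (the integrand is `Z(𝔸)`-invariant).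
The correct object is the HALF-UNFOLDED form: the orbit `{δ⁻¹ γ₀ δ′}` is parametrised by `(T(k)/Z(k)) × T′(k)`
(injectively, by `IsRegularRational`; part 1), the `T′(k)`-sum unfolds the inner integral to all of `T′(𝔸)` (Theorem
B's inner half), and the `T(k)/Z(k)`-sum of the outer integrals over the translates `σ(c) • D_T` is ONE integral over
`⋃_c σ(c) • D_T`, a fundamental domain of `Z(k)` — hence over ANY fundamental domain `D_Z` of `Z(k)`, the integrand being
`Z(k)`-invariant (`χ` and `χ′` trivial on rational points, `Z(k)` central).  No quotient measure anywhere.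

* **(b)** `tsum_orbitalc_eq_setIntegral_smul`: the inner half of Theorem B for one rational `δ` (its proof, verbatim);
* **(c)** `innerFn_central_mul`, `innerFull_central_mul`, `chi_mul_innerFull_central_smul`: the half-unfolded integrand
  is `Z(k)`-invariant (left invariance of `μ_{T′}`, `χ`, `χ′` trivial on the rational central element; no unitarity);
* **`tsum_orbit_eq_setIntegral_innerFull_of_regular`** (the cut, the planner's signature verbatim): under `R.IsHaar`,
  `IsRegularRational W γ₀`, a fundamental domain `DZ` of `Z(k)` in `T(𝔸)`, the summability of the orbit sum and
  (B1) restricted to `DZ`, (B2)–(B4) of Theorem B: `∑' γ ∈ orbit(γ₀), orbitalc γ f = ∫_{DZ} χ(t) · innerFull f γ₀ t`.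

Nothing here asserts any hypothesis or any value of the integral; nothing is about the wall's truth.  HC_CM is NOT
proved by anyone in this repository.
-/

set_option autoImplicit false

noncomputable section

namespace Summit.Ventures.HodgeRepro.Tier4.Line4

open Summit.Ventures.HodgeRepro.Tier4.Common Summit.Ventures.HodgeRepro.Tier4.Line1 MeasureTheory NumberField
open scoped Pointwise

/-! ### 4. (b) The inner half of Theorem B for one rational `δ` -/

section Inner

variable {k : Type} [Field k] [NumberField k] (W : PlaneData k)
  [MeasurableSpace (torusT W)] [MeasurableSpace (torusT' W)] (R : RTFData W)

/-- **(b) For one rational `δ`, the `T′(k)`-sum of the folded orbital integrals of `δ⁻¹ γ₀ δ′` is the integral over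
`D_T` of the half-unfolded integrand at `δ t`** (the inner half of OrbitalUnfold's Theorem B, its proof verbatim). -/
theorem tsum_orbitalc_eq_setIntegral_smul [MeasurableMul (torusT' W)] (hR : R.IsHaar)
    (f : GA W → ℂ) (γ₀ : GA W) (δ : rationalOf W (torusT W))
    (hB2 : ∀ s : torusT W, Integrable (innerFn W R f γ₀ s) R.μT')
    (hB3 : ∀ δ' : rationalOf W (torusT' W),
      Integrable (fun t : torusT W =>
        R.chi t * innerInt W R f (((δ : torusT W) : GA W)⁻¹ * γ₀ * ((δ' : torusT' W) : GA W)) t)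
        (R.μT.restrict R.DT))
    (hB4 : Summable (fun δ' : rationalOf W (torusT' W) =>
      ∫ t in R.DT, ‖R.chi t * innerInt W R f (((δ : torusT W) : GA W)⁻¹ * γ₀ * ((δ' : torusT' W) : GA W)) t‖
        ∂(R.μT))) :
    (∑' δ' : rationalOf W (torusT' W),
      R.orbitalc (((δ : torusT W) : GA W)⁻¹ * γ₀ * ((δ' : torusT' W) : GA W)) f) =
      ∫ t in R.DT, R.chi ((δ : torusT W) * t) * innerFull W R f γ₀ ((δ : torusT W) * t) ∂(R.μT) := by
  haveI hcT' : Countable (rationalOf W (torusT' W)) := countable_rationalOf W _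
  haveI : R.μT'.IsMulLeftInvariant := hR.2.1.toIsMulLeftInvariant
  haveI : SMulInvariantMeasure (torusT' W) (torusT' W) R.μT' := ⟨fun c _ _ => measure_preimage_mul R.μT' c _⟩
  haveI : SMulInvariantMeasure (rationalOf W (torusT' W)) (torusT' W) R.μT' := Subgroup.smulInvariantMeasure _
  haveI : MeasurableConstSMul (torusT' W) (torusT' W) := ⟨fun c => measurable_const_mul c⟩
  haveI : MeasurableConstSMul (rationalOf W (torusT' W)) (torusT' W) := Subgroup.instMeasurableConstSMul _
  have hinner : ∀ s : torusT W, innerFull W R f γ₀ s =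
      ∑' δ' : rationalOf W (torusT' W), ∫ t' in R.DT', innerFn W R f γ₀ s ((δ' : torusT' W) * t') ∂(R.μT') := by
    intro s
    unfold innerFull
    rw [R.DT'_fund.integral_eq_tsum'' (innerFn W R f γ₀ s) (hB2 s)]
    rfl
  have hsum : (fun t : torusT W => R.chi ((δ : torusT W) * t) * innerFull W R f γ₀ ((δ : torusT W) * t)) =
      fun t => ∑' δ' : rationalOf W (torusT' W),
        R.chi t * innerInt W R f (((δ : torusT W) : GA W)⁻¹ * γ₀ * ((δ' : torusT' W) : GA W)) t := by
    funext t
    have hin : ∀ δ' : rationalOf W (torusT' W),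
        ∫ t' in R.DT', innerFn W R f γ₀ ((δ : torusT W) * t) ((δ' : torusT' W) * t') ∂(R.μT') =
          innerInt W R f (((δ : torusT W) : GA W)⁻¹ * γ₀ * ((δ' : torusT' W) : GA W)) t := by
      intro δ'
      unfold innerInt
      refine integral_congr_ae (Filter.Eventually.of_forall fun t' => ?_)
      rw [innerFn_shift]
    rw [chi_rational_mul, hinner, tsum_mul_left]
    congr 1
    exact tsum_congr hin
  rw [hsum, ← integral_tsum_of_summable_integral_norm hB3 hB4]
  refine tsum_congr fun δ' => ?_
  refine orbitalc_eq_integral W R f _ ?_ (hB3 δ')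
  intro t
  have hmp := measurePreserving_smul (δ' : torusT' W) R.μT'
  have h := (hmp.integrable_comp_of_integrable (hB2 ((δ : torusT W) * t))).restrict (s := R.DT')
  refine h.congr (Filter.Eventually.of_forall fun t' => ?_)
  show innerFn W R f γ₀ ((δ : torusT W) * t) ((δ' : torusT' W) • t') = _
  rw [smul_eq_mul, innerFn_shift]

end Inner

/-! ### 5. (c) The half-unfolded integrand is `Z(k)`-invariant -/

section Invariance

variable {k : Type} [Field k] [NumberField k] (W : PlaneData k)
  [MeasurableSpace (torusT W)] [MeasurableSpace (torusT' W)] (R : RTFData W)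

/-- The inner integrand at `z x` is the inner integrand at `x`, left-translated by `z⁻¹` (`z ∈ Z(k)` central and
rational, so `conj χ′` does not see it). -/
theorem innerFn_central_mul (f : GA W → ℂ) (γ₀ : GA W) (z : rationalCentreT W) (x : torusT W) (t' : torusT' W) :
    innerFn W R f γ₀ ((z : torusT W) * x) t' =
      innerFn W R f γ₀ x ((centreInT' W z : torusT' W)⁻¹ * t') := by
  unfold innerFn
  have hz' : (((centreInT' W z : torusT' W)⁻¹ : torusT' W) : GA W) ∈ rationalPoints W := by
    rw [Subgroup.coe_inv, centreInT'_coe]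
    exact (rationalPoints W).inv_mem (rationalCentreT.mem_rationalPoints W z.2)
  have h1 : R.chi'conj ((centreInT' W z : torusT' W)⁻¹ * t') = R.chi'conj t' := by
    unfold RTFData.chi'conj
    rw [R.chi'_mul, R.chi'_rational _ hz', one_mul]
  rw [h1]
  have hcz : Commute γ₀ ((z : torusT W) : GA W) := rationalCentreT.comm W z.2 γ₀
  have hcinv : ((z : torusT W) : GA W)⁻¹ * γ₀ = γ₀ * ((z : torusT W) : GA W)⁻¹ := hcz.inv_right.eq.symm
  have hA : ((((z : torusT W) * x : torusT W)) : GA W)⁻¹ * γ₀ * (t' : GA W) =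
      (x : GA W)⁻¹ * γ₀ * ((((centreInT' W z : torusT' W)⁻¹ * t' : torusT' W)) : GA W) := by
    rw [Subgroup.coe_mul, Subgroup.coe_mul, Subgroup.coe_inv, centreInT'_coe, mul_inv_rev, mul_assoc, mul_assoc,
      ← mul_assoc (((z : torusT W) : GA W)⁻¹), hcinv, mul_assoc, ← mul_assoc]
  rw [hA]

/-- **The unfolded inner integral is `Z(k)`-invariant**: `innerFull f γ₀ (z x) = innerFull f γ₀ x` (left invariance
of `μ_{T′}`, `χ′` trivial on the rational central element). -/
theorem innerFull_central_mul [MeasurableMul (torusT' W)] (hR : R.IsHaar) (f : GA W → ℂ) (γ₀ : GA W)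
    (z : rationalCentreT W) (x : torusT W) :
    innerFull W R f γ₀ ((z : torusT W) * x) = innerFull W R f γ₀ x := by
  haveI : R.μT'.IsMulLeftInvariant := hR.2.1.toIsMulLeftInvariant
  unfold innerFull
  simp_rw [innerFn_central_mul W R f γ₀ z x]
  exact integral_mul_left_eq_self (innerFn W R f γ₀ x) ((centreInT' W z : torusT' W)⁻¹)

/-- **The half-unfolded integrand is `Z(k)`-invariant**: `χ(z t) · innerFull f γ₀ (z t) = χ(t) · innerFull f γ₀ t`
(`χ` trivial on `T(k)`; no unitarity). -/
theorem chi_mul_innerFull_central_smul [MeasurableMul (torusT' W)] (hR : R.IsHaar) (f : GA W → ℂ) (γ₀ : GA W)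
    (z : rationalCentreT W) (x : torusT W) :
    R.chi (z • x) * innerFull W R f γ₀ (z • x) = R.chi x * innerFull W R f γ₀ x := by
  show R.chi ((z : torusT W) * x) * innerFull W R f γ₀ ((z : torusT W) * x) = _
  rw [R.chi_mul, R.chi_rational _ (rationalCentreT.mem_rationalPoints W z.2), one_mul,
    innerFull_central_mul W R hR f γ₀ z x]

end Invariance

/-! ### 6. C-L4-UNFOLD-Z -/

section Main

variable {k : Type} [Field k] [NumberField k] (W : PlaneData k)
  [MeasurableSpace (torusT W)] [MeasurableSpace (torusT' W)] (R : RTFData W)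

/-- **C-L4-UNFOLD-Z — the HALF-UNFOLDED orbital integral of a regular rational orbit** (t4-plan-4 g3 S14244, the
signature verbatim): for `R.IsHaar`, a regular rational `γ₀`, a fundamental domain `DZ` of the rational centre `Z(k)`
in `T(𝔸)`, a summable orbit sum, (B1) restricted to `DZ` and (B2)–(B4) of Theorem B, the sum of the folded orbital
integrals over the orbit `{δ⁻¹ γ₀ δ′}` is `∫_{DZ} χ(t) ∫_{T′(𝔸)} conj χ′(t′) f(t⁻¹ γ₀ t′) dμ_{T′} dμ_T`.  Proof: (a)
the orbit is `(T(k)/Z(k)) × T′(k)` (injective by `IsRegularRational`), (b) each `T′(k)`-sum unfolds the inner integral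
over `σ(c) • D_T` (Theorem B's inner half + left invariance), (c) `⋃_c σ(c) • D_T` is a fundamental domain of `Z(k)`
and the integrand is `Z(k)`-invariant, so the integral over it equals the integral over `DZ`. -/
theorem tsum_orbit_eq_setIntegral_innerFull_of_regular [MeasurableMul (torusT W)] [MeasurableMul (torusT' W)]
    (hR : R.IsHaar) (f : GA W → ℂ) (γ₀ : rationalPoints W) (hreg : IsRegularRational W γ₀) (DZ : Set (torusT W))
    (hDZ : IsFundamentalDomain (rationalCentreT W) DZ R.μT)
    (hs : Summable (fun γ : Set.range (orbitMap W γ₀) => R.orbitalc ((γ : rationalPoints W) : GA W) f))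
    (hB1 : IntegrableOn (fun t : torusT W => R.chi t * innerFull W R f (γ₀ : GA W) t) DZ R.μT)
    (hB2 : ∀ s : torusT W, Integrable (innerFn W R f (γ₀ : GA W) s) R.μT')
    (hB3 : ∀ (δ : rationalOf W (torusT W)) (δ' : rationalOf W (torusT' W)),
      Integrable (fun t : torusT W =>
        R.chi t * innerInt W R f (((δ : torusT W) : GA W)⁻¹ * (γ₀ : GA W) * ((δ' : torusT' W) : GA W)) t)
        (R.μT.restrict R.DT))
    (hB4 : ∀ δ : rationalOf W (torusT W), Summable (fun δ' : rationalOf W (torusT' W) =>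
      ∫ t in R.DT, ‖R.chi t * innerInt W R f (((δ : torusT W) : GA W)⁻¹ * (γ₀ : GA W) * ((δ' : torusT' W) : GA W)) t‖
        ∂(R.μT))) :
    (∑' γ : Set.range (orbitMap W γ₀), R.orbitalc ((γ : rationalPoints W) : GA W) f) =
      ∫ t in DZ, R.chi t * innerFull W R f (γ₀ : GA W) t ∂(R.μT) := by
  haveI hcT : Countable (rationalOf W (torusT W)) := countable_rationalOf W _
  haveI hcZ : Countable (rationalCentreT W) := countable_rationalCentreT W
  haveI hcQ : Countable (cosetQuot W) := QuotientGroup.mk_surjective.countable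
  haveI : R.μT.IsMulLeftInvariant := hR.1.toIsMulLeftInvariant
  haveI : SMulInvariantMeasure (torusT W) (torusT W) R.μT := ⟨fun c _ _ => measure_preimage_mul R.μT c _⟩
  haveI : SMulInvariantMeasure (rationalOf W (torusT W)) (torusT W) R.μT := Subgroup.smulInvariantMeasure _
  haveI : SMulInvariantMeasure (rationalCentreT W) (torusT W) R.μT := Subgroup.smulInvariantMeasure _
  haveI : MeasurableConstSMul (torusT W) (torusT W) := ⟨fun c => measurable_const_mul c⟩
  haveI : MeasurableConstSMul (rationalOf W (torusT W)) (torusT W) := Subgroup.instMeasurableConstSMul _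
  haveI : MeasurableConstSMul (rationalCentreT W) (torusT W) := Subgroup.instMeasurableConstSMul _
  set G : torusT W → ℂ := fun t => R.chi t * innerFull W R f (γ₀ : GA W) t with hGdef
  -- (a) the orbit sum as a double sum over the coset representatives
  rw [tsum_orbit_eq_tsum_tsum_rep W R f γ₀ hreg hs]
  -- (b) each coset's sum is the integral over `σ(c) • D_T`
  have hb : ∀ c : cosetQuot W, (∑' δ' : rationalOf W (torusT' W),
      R.orbitalc (((cosetRep W c : torusT W) : GA W)⁻¹ * (γ₀ : GA W) * ((δ' : torusT' W) : GA W)) f) =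
        ∫ t in (cosetRep W c) • R.DT, G t ∂(R.μT) := by
    intro c
    rw [tsum_orbitalc_eq_setIntegral_smul W R hR f (γ₀ : GA W) (cosetRep W c) hB2 (hB3 (cosetRep W c))
      (hB4 (cosetRep W c))]
    have h := (measurePreserving_smul (cosetRep W c) R.μT).setIntegral_preimage_emb
      (measurableEmbedding_const_smul (cosetRep W c)) G ((cosetRep W c) • R.DT)
    rw [Set.preimage_smul, inv_smul_smul] at h
    exact h
  rw [tsum_congr hb]
  -- (c) the union of the translates is a fundamental domain of `Z(k)`; the integrand is `Z(k)`-invariant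
  have hD₁ : IsFundamentalDomain (rationalCentreT W) (⋃ c : cosetQuot W, (cosetRep W c) • R.DT) R.μT :=
    isFundamentalDomain_iUnion_smul_of_bijective R.DT_fund (centreIncl W) (fun _ _ => rfl) (cosetRep W)
      (bijective_centreIncl_mul_cosetRep W)
  have hGinv : ∀ (z : rationalCentreT W) (x : torusT W), G (z • x) = G x := fun z x =>
    chi_mul_innerFull_central_smul W R hR f (γ₀ : GA W) z x
  have hint : IntegrableOn G (⋃ c : cosetQuot W, (cosetRep W c) • R.DT) R.μT :=
    (hDZ.integrableOn_iff hD₁ hGinv).1 hB1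
  have hdisj : Pairwise (Function.onFun (AEDisjoint R.μT) fun c : cosetQuot W => (cosetRep W c) • R.DT) :=
    fun _ _ hne => R.DT_fund.aedisjoint fun h => hne (Quotient.out_inj.1 h)
  rw [← integral_iUnion_ae (fun c => R.DT_fund.nullMeasurableSet_smul (cosetRep W c)) hdisj hint]
  exact hD₁.setIntegral_eq hDZ hGinv

end Main

end Summit.Ventures.HodgeRepro.Tier4.Line4

end
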